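import Summits.Langlands.Langlands.Statement
import HarnessLib

/-!
# SKELETON — line `split-x4-pair-compatibility` for the crux `ReciprocityUpToIrreducibility` (item stmt-Langlands-14328;
routes OrdinaryPrimeTransport / IrreducibilityBySelfDuality), crux-strategist planner-cstrat-stmt-Langlands-14328-r1-0

Plan for piece X₄ `PairCompatibilityR` (crux; child of the split `directional-split`): reciprocity data exist
and local–global compatibility holds at every finite place for every datum — split as the revised summit itself
suggests, EXISTENCE OF THE LOCAL CORRESPONDENCE versus COMPATIBILITY AWAY FROM ℓ versus COMPATIBILITY ABOVE ℓ:

* `stub_canonicalRecExists` — `Nonempty (ReciprocityData K)`: a local Langlands datum at every completion with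
  THE canonical Artin map and canonical ε-system Artin maps (Harris–Taylor 2001 Thm A / Henniart 2000 with
  Henniart's normalisation + local class field theory; in tree: the named fact `LocalLanglandsDatum.nonempty` must be
  re-issued with canonical normalisation, lead c8's recommendation (ii); the Artin-pin debts `exists_isLocalArtinMap`,
  `IsLocalArtinMap.unique` are discharged, p136311/p136353);
* `stub_awayCompatibilityR` — Taylor 2004 Conj. 7 at v ∤ ℓ for irreducible pinned-geometric a.e.-compatible pairs
  and EVERY Henniart-normalised datum (Carayol, Harris–Taylor, Taylor–Yoshida, Caraiani, Varma 2024 up to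
  F-semisimplification for regular π over CM; in tree for every Rec on the unramified sector in every rank, leads
  c4–c6, and in rank one at all places, c7–c8; open in general);
* `stub_aboveCompatibilityR` — the same at v ∣ ℓ through Fontaine's pinned D_pst (Saito 1997, Kisin 2008, BLGGT
  2012/2014 Thm A, Caraiani 2014 for regular polarizable; in tree on the ρ-unramified sector, c3/c8; open in general).

Composition `PairCompatibilityR_of` = case split on `ℓ ∈ v`.  No stub is X₄ (existence alone has no compatibility;
each compatibility half covers half the places and assumes no datum).  Stubs are the ONLY sorries.
-/

noncomputable section
set_option linter.dupNamespace false

namespace Summit.Langlands.Langlands.Cruxes.ReciprocityUpToIrreducibility.SplitX4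

open scoped NumberField Classical Polynomial BigOperators
open Filter IsDedekindDomain Polynomial
open Literature.NumberTheory.Automorphic Literature.NumberTheory.GaloisRepresentations
open Summit.Langlands

/-- Piece X₄, verbatim as filed. -/
def PairCompatibilityR : Prop :=
  ∀ (K : Type) [Field K] [NumberField K], Nonempty (ReciprocityData K) ∧ ∀ (Rec : ReciprocityData K) (n : ℕ) (hcpt : Literature.NumberTheory.Automorphic.isCompact_glFiniteIntegralLevel n K), 0 < n → ∀ (π : Literature.NumberTheory.Automorphic.CuspidalAutomorphicRepData n K hcpt), π.1.IsLAlgebraic → ∀ (ℓ : ℕ) [Fact ℓ.Prime] (ι : PadicAlgCl ℓ ≃+* ℂ) (ρ : Literature.NumberTheory.GaloisRepresentations.FramedGaloisRep K (PadicAlgCl ℓ) n), ρ.toGaloisRep.IsIrreducible → ((∀ᶠ v : IsDedekindDomain.HeightOneSpectrum (NumberField.RingOfIntegers K) in Filter.cofinite, ρ.IsUnramifiedAt v) ∧ ∀ (v : IsDedekindDomain.HeightOneSpectrum (NumberField.RingOfIntegers K)) (hv : ((ℓ : ℕ) : NumberField.RingOfIntegers K) ∈ v.asIdeal), (Literature.NumberTheory.PAdicHodge.fontainePstAdicCompletion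 v ℓ hv).IsDeRhamFramed (ρ.toLocal v)) → (∀ᶠ v : IsDedekindDomain.HeightOneSpectrum (NumberField.RingOfIntegers K) in Filter.cofinite, Summit.Langlands.SatakeFrobCompatibleAt ι π.1 ρ v) → ∀ v : IsDedekindDomain.HeightOneSpectrum (NumberField.RingOfIntegers K), Summit.Langlands.LocalGlobalCompatibleAt Rec ι π.1 ρ v

/-- **Canonically normalised reciprocity data exist (local Langlands for GL_n, Harris–Taylor Thm A / Henniart, with the pinned Artin normalisations; tree debt: `LocalLanglandsDatum.nonempty` re-issued canonically).** [cite: HarrisTaylorAMS2001, Thm. A] [cite: SerreLocalFields1979, Ch. XIII §4] -/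
theorem stub_canonicalRecExists :
    ∀ (K : Type) [Field K] [NumberField K], Nonempty (ReciprocityData K) := by
  sorry

/-- **Local–global compatibility at v ∤ ℓ for every datum (OPEN in general; Taylor 2004 Conj. 7; Harris–Taylor, Taylor–Yoshida, Caraiani, Varma 2024).** [cite: TaylorGaloisRepresentations2004, Conj. 7] [cite: HarrisTaylorAMS2001, Thm. B] -/
theorem stub_awayCompatibilityR :
    ∀ (K : Type) [Field K] [NumberField K] (Rec : ReciprocityData K) (n : ℕ) (hcpt : Literature.NumberTheory.Automorphic.isCompact_glFiniteIntegralLevel n K), 0 < n → ∀ (π : Literature.NumberTheory.Automorphic.CuspidalAutomorphicRepData n K hcpt), π.1.IsLAlgebraic → ∀ (ℓ : ℕ) [Fact ℓ.Prime] (ι : PadicAlgCl ℓ ≃+* ℂ) (ρ : Literature.NumberTheory.GaloisRepresentations.FramedGaloisRep K (PadicAlgCl ℓ) n), ρ.toGaloisRep.IsIrreducible → ((∀ᶠ v : IsDedekindDomain.HeightOneSpectrum (NumberField.RingOfIntegers K) in Filter.cofinite, ρ.IsUnramifiedAt v) ∧ ∀ (v : IsDedekindDomain.HeightOneSpectrum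 (NumberField.RingOfIntegers K)) (hv : ((ℓ : ℕ) : NumberField.RingOfIntegers K) ∈ v.asIdeal), (Literature.NumberTheory.PAdicHodge.fontainePstAdicCompletion v ℓ hv).IsDeRhamFramed (ρ.toLocal v)) → (∀ᶠ v : IsDedekindDomain.HeightOneSpectrum (NumberField.RingOfIntegers K) in Filter.cofinite, Summit.Langlands.SatakeFrobCompatibleAt ι π.1 ρ v) → ∀ v : IsDedekindDomain.HeightOneSpectrum (NumberField.RingOfIntegers K), ((ℓ : ℕ) : NumberField.RingOfIntegers K) ∉ v.asIdeal → Summit.Langlands.LocalGlobalCompatibleAt Rec ι π.1 ρ v := by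
  sorry

/-- **Local–global compatibility at v ∣ ℓ through Fontaine's pinned D_pst, every datum (OPEN in general; Saito 1997, Kisin 2008, BLGGT 2014 Thm A, Caraiani 2014).** [cite: TaylorGaloisRepresentations2004, Conj. 7] [cite: FontaineAsterisque223VIII, §2.3.7] -/
theorem stub_aboveCompatibilityR :
    ∀ (K : Type) [Field K] [NumberField K] (Rec : ReciprocityData K) (n : ℕ) (hcpt : Literature.NumberTheory.Automorphic.isCompact_glFiniteIntegralLevel n K), 0 < n → ∀ (π : Literature.NumberTheory.Automorphic.CuspidalAutomorphicRepData n K hcpt), π.1.IsLAlgebraic → ∀ (ℓ : ℕ) [Fact ℓ.Prime] (ι : PadicAlgCl ℓ ≃+* ℂ) (ρ : Literature.NumberTheory.GaloisRepresentations.FramedGaloisRep K (PadicAlgCl ℓ) n), ρ.toGaloisRep.IsIrreducible → ((∀ᶠ v : IsDedekindDomain.HeightOneSpectrum (NumberField.RingOfIntegers K) in Filter.cofinite, ρ.IsUnramifiedAt v) ∧ ∀ (v : IsDedekindDomain.HeightOneSpectrum (NumberField.RingOfIntegers K)) (hv : ((ℓ : ℕ) : NumberField.RingOfIntegers K) ∈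 v.asIdeal), (Literature.NumberTheory.PAdicHodge.fontainePstAdicCompletion v ℓ hv).IsDeRhamFramed (ρ.toLocal v)) → (∀ᶠ v : IsDedekindDomain.HeightOneSpectrum (NumberField.RingOfIntegers K) in Filter.cofinite, Summit.Langlands.SatakeFrobCompatibleAt ι π.1 ρ v) → ∀ v : IsDedekindDomain.HeightOneSpectrum (NumberField.RingOfIntegers K), ((ℓ : ℕ) : NumberField.RingOfIntegers K) ∈ v.asIdeal → Summit.Langlands.LocalGlobalCompatibleAt Rec ι π.1 ρ v := by
  sorry

/-- **COMPOSITION — piece X₄ from the three stubs** (existence; then case split on `ℓ ∈ v`). -/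
theorem PairCompatibilityR_of : PairCompatibilityR := by
  intro K _ _
  refine ⟨stub_canonicalRecExists K, fun Rec n hcpt hn π hL ℓ _ ι ρ hirr hgeo hρ v => ?_⟩
  by_cases hv : ((ℓ : ℕ) : NumberField.RingOfIntegers K) ∈ v.asIdeal
  · exact stub_aboveCompatibilityR K Rec n hcpt hn π hL ℓ ι ρ hirr hgeo hρ v hv
  · exact stub_awayCompatibilityR K Rec n hcpt hn π hL ℓ ι ρ hirr hgeo hρ v hv

end Summit.Langlands.Langlands.Cruxes.ReciprocityUpToIrreducibility.SplitX4

end
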